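import Summits.AnomalousDissipation.AnomalousDissipation.Theses.BoussinesqOctaves

/-!
# Birth skeleton (BC3) of child 1 `K41Tower` of the tower split of `BoussinesqLadder`

Line: the route's own rank-2 crux `OctaveTower` (the constructive viscosity LADDER of K41 forced-NS-Reynolds
subsolutions: one dissipation-range octave per viscosity halving, increments `⟨‖U_{n+1} − U_n‖²⟩ ≤ C√ν_n`)
is the natural sufficient condition; the only extra clause of `K41Tower` — a ν-uniform mean-energy bound —
is what summable increments buy (`stub_towerEnergy`: Minkowski / `(1+η)`-parallelogram bookkeeping for the
`limsup` long-time means of smooth periodic fields, a provable M-sized lemma). Composition `K41Tower_of` is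
real (projection of the ladder's clauses + the energy bound).

Stubs: `stub_octaveTower` (= crux OctaveTower, stmt-AnomalousDissipation-1450: the stress-realisation
half at the Onsager endpoint β = 1/3, BuckmasterVicol2020 Rem. 6.4) · `stub_towerEnergy` (support-grade).
-/

set_option linter.dupNamespace false
noncomputable section

open Set Function
open Literature.Analysis.FunctionSpaces Literature.Analysis.FunctionSpaces.Torus
open Literature.Analysis.FluidPDE
open Summit.AnomalousDissipation.AnomalousDissipation.Theses.BoussinesqOctaves

namespace Summit.AnomalousDissipation.AnomalousDissipation.Cruxes.BoussinesqLadder.K41TowerBirth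

namespace TowerSplit

/-- **Child 1 — `K41Tower` (crux, ∃; the subsolution half).** One smooth steady divergence-free
mean-zero force `f`, a geometric ladder `ν_n = ν₀σⁿ` and, on EVERY rung, a `τ_n`-periodic classical
forced-NS-Reynolds subsolution `(U_n, P_n, R_n)` (Navier–Stokes at viscosity `ν_n` with force
`f + div R_n`, `R_n` jointly smooth, symmetric, `τ_n`-periodic) in the K41 class — mean-zero velocities,
Kolmogorov gradient cap `‖∂ᵢU_n‖ ≤ A/√ν_n`, residual stress `‖R_n eⱼ‖ ≤ B√ν_n` — with ν-UNIFORM mean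
energy `⟨‖U_n‖₂²⟩ ≤ E` and injection floor `⟨∫⟪f, U_n⟫⟩ ≥ ε > 0`. -/
def K41Tower : Prop :=
  ∃ f : UnitAddTorus (Fin 3) → EuclideanSpace ℝ (Fin 3), Literature.Analysis.FunctionSpaces.Torus.IsSmooth f ∧ Literature.Analysis.FunctionSpaces.Torus.IsDivFree f ∧ Literature.Analysis.FunctionSpaces.Torus.HasZeroMean f ∧ ∃ (ν₀ σ A B E ε : ℝ) (τ : ℕ → ℝ) (U : ℕ → ℝ → UnitAddTorus (Fin 3) → EuclideanSpace ℝ (Fin 3)) (P : ℕ → ℝ → UnitAddTorus (Fin 3) → ℝ) (R : ℕ → ℝ → UnitAddTorus (Fin 3) → Fin 3 → EuclideanSpace ℝ (Fin 3)), 0 < ν₀ ∧ 0 < σ ∧ σ < 1 ∧ 0 < ε ∧ ∀ n, 0 < τ n ∧ Function.Periodic (U n) (τ n) ∧ Function.Periodic (R n) (τ n) ∧ (∀ t, Literature.Analysis.FunctionSpaces.Torus.HasZeroMean (U n t)) ∧ Literature.Analysis.FunctionSpaces.Torus.IsSmoothSpaceTimeOn Set.univ (R n) ∧ (∀ t x (i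 j : Fin 3), R n t x i j = R n t x j i) ∧ Literature.Analysis.FunctionSpaces.Torus.IsClassicalNSSolutionOn Set.univ (ν₀ * σ ^ n) (fun t x => f x + Literature.Analysis.FluidPDE.Torus.tensorDivergence (R n t) x) (U n) (P n) ∧ (∀ t x (i : Fin 3), ‖Literature.Analysis.FunctionSpaces.Torus.partialDeriv i (U n t) x‖ ≤ A / Real.sqrt (ν₀ * σ ^ n)) ∧ (∀ t x (j : Fin 3), ‖R n t x j‖ ≤ B * Real.sqrt (ν₀ * σ ^ n)) ∧ Literature.Analysis.FluidPDE.meanEnergy (U n) ≤ E ∧ ε ≤ Literature.Analysis.FluidPDE.longTimeAvgSup (fun t => MeasureTheory.integral MeasureTheory.volume (fun x => inner ℝ (f x) (U n t x)))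

/-- **Child 2 — `TowerClosing` (crux, ∀∃; the closing law over the class of child 1).** For every
force, ladder and K41 forced-NS-Reynolds subsolution tower as in `K41Tower` there are `N`, `D`, `θ > 0`
and, for every rung `n ≥ N`, an EXACT `τ'_n`-periodic classical solution `(u_n, p_n)` of NS_{ν_n} forced
by `f` alone that shadows the tower within one dissipation-range octave in mean energy,
`⟨‖u_n − U_n‖₂²⟩ ≤ D√ν_n`, and absorbs the fraction `θ` of the injected power, `⟨∫⟪f, u_n⟫⟩ ≥ θε`. -/
def TowerClosing : Prop :=
  ∀ f : UnitAddTorus (Fin 3) → EuclideanSpace ℝ (Fin 3), Literature.Analysis.FunctionSpaces.Torus.IsSmooth f → Literature.Analysis.FunctionSpaces.Torus.IsDivFree f → Literature.Analysis.FunctionSpaces.Torus.HasZeroMean f → ∀ (ν₀ σ A B E ε : ℝ) (τ : ℕ → ℝ) (U : ℕ → ℝ → UnitAddTorus (Fin 3) → EuclideanSpace ℝ (Fin 3)) (P : ℕ → ℝ → UnitAddTorus (Fin 3) → ℝ) (R : ℕ → ℝ → UnitAddTorus (Fin 3) → Fin 3 → EuclideanSpace ℝ (Fin 3)), 0 < ν₀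 → 0 < σ → σ < 1 → 0 < ε → (∀ n, 0 < τ n ∧ Function.Periodic (U n) (τ n) ∧ Function.Periodic (R n) (τ n) ∧ (∀ t, Literature.Analysis.FunctionSpaces.Torus.HasZeroMean (U n t)) ∧ Literature.Analysis.FunctionSpaces.Torus.IsSmoothSpaceTimeOn Set.univ (R n) ∧ (∀ t x (i j : Fin 3), R n t x i j = R n t x j i) ∧ Literature.Analysis.FunctionSpaces.Torus.IsClassicalNSSolutionOn Set.univ (ν₀ * σ ^ n) (fun t x => f x + Literature.Analysis.FluidPDE.Torus.tensorDivergence (R n t) x) (U n) (P n) ∧ (∀ t x (i : Fin 3), ‖Literature.Analysis.FunctionSpaces.Torus.partialDeriv i (U n t) x‖ ≤ A / Real.sqrt (ν₀ * σ ^ n)) ∧ (∀ t x (j : Fin 3), ‖R n t x j‖ ≤ B * Real.sqrt (ν₀ * σ ^ n)) ∧ Literature.Analysis.FluidPDE.meanEnergy (U n) ≤ E ∧ ε ≤ Literature.Analysis.FluidPDE.longTimeAvgSup (fun t => MeasureTheory.integral MeasureTheory.volume (fun x => inner ℝ (f x) (U n t x)))) → ∃ (N : ℕ) (D θ : ℝ)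 (τ' : ℕ → ℝ) (u : ℕ → ℝ → UnitAddTorus (Fin 3) → EuclideanSpace ℝ (Fin 3)) (p : ℕ → ℝ → UnitAddTorus (Fin 3) → ℝ), 0 < θ ∧ ∀ n, N ≤ n → Literature.Analysis.FunctionSpaces.Torus.IsClassicalNSSolutionOn Set.univ (ν₀ * σ ^ n) (fun _ => f) (u n) (p n) ∧ 0 < τ' n ∧ Function.Periodic (u n) (τ' n) ∧ Literature.Analysis.FluidPDE.meanEnergy (u n - U n) ≤ D * Real.sqrt (ν₀ * σ ^ n) ∧ θ * ε ≤ Literature.Analysis.FluidPDE.longTimeAvgSup (fun t => MeasureTheory.integral MeasureTheory.volume (fun x => inner ℝ (f x) (u n t x)))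

end TowerSplit

/-- **stub_octaveTower** — the route's rank-2 crux `OctaveTower` (stmt-AnomalousDissipation-1450): a K41
forced-NS-Reynolds subsolution LADDER with residual stress `≤ B√ν_n`, Kolmogorov gradient cap, dissipation-range
increments `⟨‖U_{n+1} − U_n‖²⟩ ≤ C√ν_n` and a ν-uniform injection floor. Hardest stub (open; the β = 1/3
endpoint of truncated convex integration with a FIXED force). -/
theorem stub_octaveTower : OctaveTower := by
  sorry

/-- **stub_towerEnergy** — summable dissipation-range increments give a ν-uniform mean-energy bound along the
ladder: if each `U_n` is jointly smooth and `τ_n`-periodic and `⟨‖U_{n+1} − U_n‖₂²⟩ ≤ C√(ν₀σⁿ)` (`0 < σ < 1`),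
then `sup_n ⟨‖U_n‖₂²⟩ < ∞`. (Minkowski for the `limsup` means of fields with incommensurable periods, or the
square-root-free form `⟨‖a + b‖²⟩ ≤ (1+η)⟨‖a‖²⟩ + (1+η⁻¹)⟨‖b‖²⟩` with `η_n = σ^{n/4}` and `∏(1+η_n) < ∞`;
support-grade, provable now.) -/
theorem stub_towerEnergy : ∀ (ν₀ σ C : ℝ) (τ : ℕ → ℝ)
    (U : ℕ → ℝ → UnitAddTorus (Fin 3) → EuclideanSpace ℝ (Fin 3)), 0 < ν₀ → 0 < σ → σ < 1 →
    (∀ n, 0 < τ n ∧ Function.Periodic (U n) (τ n) ∧ IsSmoothSpaceTimeOn Set.univ (U n) ∧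
      meanEnergy (U (n + 1) - U n) ≤ C * Real.sqrt (ν₀ * σ ^ n)) →
    ∃ E : ℝ, ∀ n, meanEnergy (U n) ≤ E := by
  sorry

/-- **Composition** `K41Tower_of : stub_octaveTower → stub_towerEnergy → K41Tower` (real proof): take the ladder
of `OctaveTower`; its velocities are jointly smooth (classical solutions), so `stub_towerEnergy` turns the
increment clause into a ν-uniform energy bound `E`; every other clause of `K41Tower` is a clause of the ladder. -/
theorem K41Tower_of (h₁ : OctaveTower)
    (h₂ : ∀ (ν₀ σ C : ℝ) (τ : ℕ → ℝ)
      (U : ℕ → ℝ → UnitAddTorus (Fin 3) → EuclideanSpace ℝ (Fin 3)), 0 < ν₀ → 0 < σ → σ < 1 →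
      (∀ n, 0 < τ n ∧ Function.Periodic (U n) (τ n) ∧ IsSmoothSpaceTimeOn Set.univ (U n) ∧
        meanEnergy (U (n + 1) - U n) ≤ C * Real.sqrt (ν₀ * σ ^ n)) →
      ∃ E : ℝ, ∀ n, meanEnergy (U n) ≤ E) :
    TowerSplit.K41Tower := by
  obtain ⟨f, hf, hdiv, hmean, ν₀, σ, A, B, C, ε, τ, U, P, R, hν₀, hσ0, hσ1, hε, hT⟩ := h₁
  obtain ⟨E, hE⟩ := h₂ ν₀ σ C τ U hν₀ hσ0 hσ1 fun n =>
    ⟨(hT n).1, (hT n).2.1, (hT n).2.2.2.2.2.2.1.smooth_velocity, (hT n).2.2.2.2.2.2.2.2.2.1⟩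
  refine ⟨f, hf, hdiv, hmean, ν₀, σ, A, B, E, ε, τ, U, P, R, hν₀, hσ0, hσ1, hε, fun n => ?_⟩
  obtain ⟨hτ, hpU, hpR, hzm, hRs, hRsym, hsol, hgrad, hres, -, hinj⟩ := hT n
  exact ⟨hτ, hpU, hpR, hzm, hRs, hRsym, hsol, hgrad, hres, hE n, hinj⟩

/-- The skeleton closes the piece: `K41Tower` from the two stubs. -/
theorem K41Tower_holds_of_stubs : TowerSplit.K41Tower :=
  K41Tower_of stub_octaveTower stub_towerEnergy

end Summit.AnomalousDissipation.AnomalousDissipation.Cruxes.BoussinesqLadder.K41TowerBirth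

end
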